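import Mathlib
import Summits.NavierStokesRegularity.NavierStokesRegularity.Theorems.EulerZoomLiouvillePowerGaugeEulerLiouvilleSelfSimilarEndpointIteration
import Summits.NavierStokesRegularity.NavierStokesRegularity.Theorems.EulerZoomLiouvillePowerGaugeEulerLiouvilleSelfSimilarEndpointFlux
import Summits.NavierStokesRegularity.NavierStokesRegularity.Theorems.EulerZoomLiouvillePowerGaugeEulerLiouvilleSelfSimilarEndpointPressure
import HarnessLib

/-!
# Rung C1 of the crux `EulerZoomLiouville.PowerGaugeEulerLiouville` at the endpoint `ρ = 1/2`:
# shell-energy drain of profiles with sublinear growth (weak class)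

Route №10 `EulerZoomLiouville` (NavierStokesRegularity), crux E = stmt-NavierStokesRegularity-19832,
tenure rung C1 (exactly self-similar members) at the energy-conserving endpoint `ρ = 1/2`
(Chae–Shvydkoy `α = N/2`).  PROFILE-LEVEL conclusions for a pair `(V, P)` on `ℝ³` with
`V ∈ L² ∩ L³_loc`, `|P||V| ∈ L¹_loc`, the forward profile local energy inequality of the class
(`…SelfSimilarLEI` / `…SelfSimilarTransfer`, at `γ = 2/5`), the Riesz representation of `P` at
large scales and the sublinear growth `‖V(y)‖ ≤ C_up |y|^{1−δ}` (`|y| ≥ R₀`, `0 < δ ≤ 1`):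

* `windowSum_ge_setIntegral` — the energy of `{L/8 ≤ |y| < 32L}` is dominated by the dyadic
  window sum `Σ_{k=0}^{10} e(2^k L/32)` of the shell energies `e(l) = ∫_{l ≤ |y| < 2l} ‖V‖²`;
* `shell_energy_decay_half` — **energy drain**: for every `ε > 0`, `e(L) ≤ C_ε L^{−5+ε}`
  (`L ≥ 1`).  This is the rate `L^{−(N+2)+ε}` which Shvydkoy's energy-measure paper obtains in
  the smooth setting (quoted in Bronzi–Shvydkoy, arXiv:1310.8611, Remark 1.5), here for suitable
  weak profiles: flux lemma + shell pressure/cubic estimates + the real-variable iteration;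
* (sequel `…EndpointLiouville`: Chae–Shvydkoy's Thm 3.1 in the weak class — with a lower power
  bound the drain rate is contradictory.)

WHAT THIS IS NOT: not NS, not E, not rung C1 — the endpoint profile Liouville theorem WITHOUT a
lower bound (the open Chae–Shvydkoy endpoint) is untouched: decay never yields triviality.
-/

noncomputable section

-- flat `Theorems/<Route><Decl>…` files of one crux share the namespace of the crux (tree convention)
set_option linter.dupNamespace false

open MeasureTheory Set Filter Topology Metric Function Finset
open scoped ENNReal NNReal InnerProductSpace RealInnerProductSpace

namespace Summit.NavierStokesRegularity.NavierStokesRegularity.Theorems.PowerGaugeEulerLiouville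

open Literature.Analysis Literature.Analysis.FluidPDE

section Window

variable {V : EuclideanSpace ℝ (Fin 3) → EuclideanSpace ℝ (Fin 3)}

/-- **The mid annulus is covered by the dyadic window.**  For `g = ‖V‖² ∈ L¹` and `L > 0`,
`∫_{L/8 ≤ |y| < 32L} ‖V‖² ≤ Σ_{k=0}^{10} ∫_{2^k L/32 ≤ |y| < 2^{k+1} L/32} ‖V‖²`
(every point of the annulus lies in one of the dyadic shells). [folklore] -/
theorem windowSum_ge_setIntegral (hV2 : Integrable (fun z => ‖V z‖ ^ 2) volume) {L : ℝ}
    (hL : 0 < L) :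
    ∫ y in {y | L / 8 ≤ ‖y‖ ∧ ‖y‖ < 32 * L}, ‖V y‖ ^ 2 ≤
      ∑ k ∈ range (2 * 5 + 1),
        ∫ y in {y | 2 ^ k * L / 2 ^ 5 ≤ ‖y‖ ∧ ‖y‖ < 2 * (2 ^ k * L / 2 ^ 5)}, ‖V y‖ ^ 2 := by
  set T : Set (EuclideanSpace ℝ (Fin 3)) := {y | L / 8 ≤ ‖y‖ ∧ ‖y‖ < 32 * L} with hT
  set A : ℕ → Set (EuclideanSpace ℝ (Fin 3)) := fun k =>
    {y | 2 ^ k * L / 2 ^ 5 ≤ ‖y‖ ∧ ‖y‖ < 2 * (2 ^ k * L / 2 ^ 5)} with hA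
  have hTm : MeasurableSet T := (measurableSet_le measurable_const measurable_norm).inter
    (measurableSet_lt measurable_norm measurable_const)
  have hAm : ∀ k, MeasurableSet (A k) := fun k =>
    (measurableSet_le measurable_const measurable_norm).inter
      (measurableSet_lt measurable_norm measurable_const)
  -- rewrite as integrals of indicators
  rw [← integral_indicator hTm]
  have hAk : ∀ k ∈ range (2 * 5 + 1),
      ∫ y in A k, ‖V y‖ ^ 2 = ∫ y, (A k).indicator (fun y => ‖V y‖ ^ 2) y :=
    fun k _ => (integral_indicator (hAm k)).symm
  rw [sum_congr rfl hAk, ← integral_finsetSum _ (fun k _ => hV2.indicator (hAm k))]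
  refine integral_mono (hV2.indicator hTm) (integrable_finsetSum _ fun k _ => hV2.indicator (hAm k))
    fun y => ?_
  by_cases hy : y ∈ T
  · -- `y` lies in the shell `A k₀`, `k₀ = ⌊log₂ (32|y|/L)⌋ ≤ 9`
    have hy1 : 1 ≤ ‖y‖ / (L / 2 ^ 5) := by
      rw [le_div_iff₀ (by positivity)]; norm_num; linarith [hy.1]
    obtain ⟨k₀, hk₁, hk₂⟩ := exists_nat_pow_near hy1 (by norm_num : (1 : ℝ) < 2)
    have hk₀ : k₀ < 2 * 5 + 1 := by
      by_contra hge
      rw [not_lt] at hge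
      have h2 : (2 : ℝ) ^ (2 * 5 + 1) ≤ (2 : ℝ) ^ k₀ := pow_le_pow_right₀ (by norm_num) hge
      have h3 : ‖y‖ / (L / 2 ^ 5) < (2 : ℝ) ^ (2 * 5 + 1) := by
        rw [div_lt_iff₀ (by positivity)]; norm_num; linarith [hy.2]
      exact lt_irrefl _ ((h2.trans hk₁).trans_lt h3)
    have hyk : y ∈ A k₀ := by
      refine ⟨?_, ?_⟩
      · rw [le_div_iff₀ (by positivity)] at hk₁
        have : (2 : ℝ) ^ k₀ * L / 2 ^ 5 = 2 ^ k₀ * (L / 2 ^ 5) := by ring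
        rw [this]; exact hk₁
      · rw [div_lt_iff₀ (by positivity), pow_succ] at hk₂
        have : 2 * ((2 : ℝ) ^ k₀ * L / 2 ^ 5) = 2 ^ k₀ * 2 * (L / 2 ^ 5) := by ring
        rw [this]; exact hk₂
    rw [indicator_of_mem hy]
    calc ‖V y‖ ^ 2 = (A k₀).indicator (fun y => ‖V y‖ ^ 2) y := by rw [indicator_of_mem hyk]
      _ ≤ ∑ k ∈ range (2 * 5 + 1), (A k).indicator (fun y => ‖V y‖ ^ 2) y :=
          single_le_sum (f := fun k => (A k).indicator (fun y => ‖V y‖ ^ 2) y)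
            (fun k _ => indicator_nonneg (fun _ _ => by positivity) _) (mem_range.2 hk₀)
  · rw [indicator_of_notMem hy]
    exact sum_nonneg fun k _ => indicator_nonneg (fun _ _ => by positivity) _

end Window

section Scaling

/-- Exponent bookkeeping: `(a L)^{1−δ} / L = a^{1−δ} L^{−δ}` (`a, L > 0`). [folklore] -/
theorem mul_rpow_one_sub_div {a L δ : ℝ} (ha : 0 < a) (hL : 0 < L) :
    (a * L) ^ (1 - δ) / L = a ^ (1 - δ) * L ^ (-δ) := by
  rw [Real.mul_rpow ha.le hL.le, mul_div_assoc]
  congr 1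
  have h : L ^ (1 - δ) = L ^ (-δ) * L := by
    rw [← Real.rpow_add_one hL.ne']; congr 1; ring
  rw [h, mul_div_cancel_right₀ _ hL.ne']

/-- Exponent bookkeeping for the far-field term:
`(1/(2π (L/8)³)) √((8L)³ v) / L = (512 √(512 v)/(2π)) L^{−5/2}` (`L > 0`, `v ≥ 0`). [folklore] -/
theorem farField_scaling {L v : ℝ} (hL : 0 < L) (hv : 0 ≤ v) :
    1 / (2 * Real.pi * (L / 8) ^ 3) * Real.sqrt ((8 * L) ^ 3 * v) / L =
      512 * Real.sqrt (512 * v) / (2 * Real.pi) * L ^ (-(5 / 2 : ℝ)) := by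
  have h8L : (8 * L) ^ 3 * v = (512 * v) * L ^ 3 := by ring
  have hsq : Real.sqrt ((8 * L) ^ 3 * v) = Real.sqrt (512 * v) * L ^ (3 / 2 : ℝ) := by
    rw [h8L, Real.sqrt_mul (by positivity), Real.sqrt_eq_rpow (L ^ 3), ← Real.rpow_natCast,
      ← Real.rpow_mul hL.le]
    norm_num
  have hL8 : (L / 8) ^ 3 = L ^ 3 / 512 := by ring
  rw [hsq, hL8]
  have hL52 : L ^ (-(5 / 2 : ℝ)) = L ^ (3 / 2 : ℝ) / (L ^ 3 * L) := by
    rw [eq_div_iff (by positivity), ← Real.rpow_natCast, ← Real.rpow_add_one hL.ne',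
      ← Real.rpow_add hL]
    norm_num
  rw [hL52]
  field_simp

end Scaling

section Decay

variable {V : EuclideanSpace ℝ (Fin 3) → EuclideanSpace ℝ (Fin 3)} {P : EuclideanSpace ℝ (Fin 3) → ℝ}

/-- **Energy drain of endpoint profiles with sublinear growth (weak class).**  Let `(V, P)` be
a profile pair with `V ∈ L²(ℝ³) ∩ L³_loc`, `|P||V| ∈ L¹_loc`, the forward profile local energy
inequality of the class at `γ = 2/5` (`ρ = 1/2`), the Riesz representation
`P = Π[V·1_{B_R}] + ∫_{|z| ≥ R} K(·−z)(V z) dz` a.e. on `|y| < R/2` for all `R ≥ R₁`, and the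
sublinear growth `‖V(y)‖ ≤ C_up |y|^{1−δ}` a.e. on `|y| ≥ R₀` (`0 < δ ≤ 1`).  Then for every
`ε > 0` there is `C` with `∫_{L ≤ |y| < 2L} ‖V‖² ≤ C L^{−5+ε}` for all `L ≥ 1`
(Chae–Shvydkoy's recursion (3.3) with sublinear far field, iterated to the fixed point `5`).
[cite: ChaeShvydkoy2013, §3.1 proof of Thm. 3.1; BronziShvydkoy2015, Remark 1.5] -/
theorem shell_energy_decay_half
    (hVm : AEStronglyMeasurable V volume) (hV2 : Integrable (fun z => ‖V z‖ ^ 2) volume)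
    (hV3 : LocallyIntegrable (fun y => ‖V y‖ ^ 3) volume)
    (hPV : LocallyIntegrable (fun y => |P y| * ‖V y‖) volume)
    {γ : ℝ} (hγ : γ = 2 / 5)
    (hLEI : ∀ σ : EuclideanSpace ℝ (Fin 3) → ℝ, ContDiff ℝ (⊤ : ℕ∞) σ → HasCompactSupport σ →
      (∀ x, 0 ≤ σ x) →
      ∀ᵐ τ₁ : ℝ, τ₁ < 0 → ∀ᵐ τ₂ : ℝ, τ₂ ∈ Ioo τ₁ 0 →
        (-τ₂) ^ (5 * γ - 2) * ∫ y, ‖V y‖ ^ 2 * σ ((-τ₂) ^ γ • y) ≤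
          ((-τ₁) ^ (5 * γ - 2) * ∫ y, ‖V y‖ ^ 2 * σ ((-τ₁) ^ γ • y)) +
            ∫ τ in Ico τ₁ τ₂, (-τ) ^ (6 * γ - 3) *
              ∫ y, (‖V y‖ ^ 2 + 2 * P y) * ⟪V y, gradient σ ((-τ) ^ γ • y)⟫)
    {R₁ : ℝ}
    (hP : ∀ R : ℝ, R₁ ≤ R → ∀ᵐ y ∂volume, ‖y‖ < R / 2 →
      P y = rieszPressure ((ball (0 : EuclideanSpace ℝ (Fin 3)) R).indicator V) y +
        ∫ z in {z | R ≤ ‖z‖}, pressureKernel (y - z) (V z))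
    {δ Cup R₀ : ℝ} (hδ : 0 < δ) (hδ1 : δ ≤ 1) (hCup : 0 ≤ Cup)
    (hup : ∀ᵐ y ∂volume, R₀ ≤ ‖y‖ → ‖V y‖ ≤ Cup * ‖y‖ ^ (1 - δ))
    {ε : ℝ} (hε : 0 < ε) :
    ∃ C : ℝ, ∀ L : ℝ, 1 ≤ L →
      ∫ y in {y | L ≤ ‖y‖ ∧ ‖y‖ < 2 * L}, ‖V y‖ ^ 2 ≤ C * L ^ (-(5 : ℝ) + ε) := by
  -- constants
  obtain ⟨K, hK0, hK⟩ := shell_energy_le_flux_of_profileLEI_half hγ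
    (hV2.locallyIntegrable) hV3 hPV hLEI
  obtain ⟨C_S, hCS⟩ := exists_eLpNorm_rieszPressure_two_le
  set E₂ : ℝ := ∫ z, ‖V z‖ ^ 2 with hE₂
  have hE₂0 : 0 ≤ E₂ := integral_nonneg fun z => by positivity
  set v₁ : ℝ := volume.real (ball (0 : EuclideanSpace ℝ (Fin 3)) 1) with hv₁
  have hv₁0 : 0 ≤ v₁ := measureReal_nonneg
  -- the shell energies and the window sum
  set f : ℝ → ℝ := fun L => ∫ y in {y | L ≤ ‖y‖ ∧ ‖y‖ < 2 * L}, ‖V y‖ ^ 2 with hf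
  set S : ℝ → ℝ := fun L => ∑ k ∈ range (2 * 5 + 1), f (2 ^ k * L / 2 ^ 5) with hS
  have hf0 : ∀ L, 0 < L → 0 ≤ f L := fun L _ =>
    setIntegral_nonneg ((measurableSet_le measurable_const measurable_norm).inter
      (measurableSet_lt measurable_norm measurable_const)) fun y _ => by positivity
  have hfB : ∀ L, 0 < L → f L ≤ E₂ := fun L _ =>
    setIntegral_le_integral hV2 (Eventually.of_forall fun y => by positivity)
  -- the recursion constants
  set C₁ : ℝ := K * Cup * ((8 : ℝ) ^ (1 - δ) + 2 * C_S * (32 : ℝ) ^ (1 - δ)) with hC₁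
  set C₂ : ℝ := K * (4 * E₂ * (512 * Real.sqrt (512 * v₁) / (2 * Real.pi))) with hC₂
  have hC₁0 : 0 ≤ C₁ := by positivity
  have hC₂0 : 0 ≤ C₂ := by positivity
  set L₁ : ℝ := max (8 * R₀) (max (R₁ / 32) 1) with hL₁
  have hL₁1 : 1 ≤ L₁ := le_max_of_le_right (le_max_right _ _)
  have hL₁0 : 0 < L₁ := one_pos.trans_le hL₁1
  -- the recursion
  have hrec : ∀ L, L₁ ≤ L → f L ≤ C₁ * L ^ (-δ) * S L + C₂ * Real.sqrt (S L) * L ^ (-(5 / 2 : ℝ)) := by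
    intro L hLL
    have hL : 0 < L := hL₁0.trans_le hLL
    have hR₀L : R₀ ≤ L / 8 := by
      have : 8 * R₀ ≤ L := (le_max_left _ _).trans hLL
      linarith
    have hR₁L : R₁ ≤ 32 * L := by
      have : R₁ / 32 ≤ L := (le_max_left _ _).trans ((le_max_right _ _).trans hLL)
      linarith
    -- the sets and their energies
    set eS : ℝ := ∫ y in {y | L / 4 ≤ ‖y‖ ∧ ‖y‖ ≤ 8 * L}, ‖V y‖ ^ 2 with heS
    set eT : ℝ := ∫ y in {y | L / 8 ≤ ‖y‖ ∧ ‖y‖ < 32 * L}, ‖V y‖ ^ 2 with heT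
    have hSm : MeasurableSet {y : EuclideanSpace ℝ (Fin 3) | L / 4 ≤ ‖y‖ ∧ ‖y‖ ≤ 8 * L} :=
      (measurableSet_le measurable_const measurable_norm).inter
        (measurableSet_le measurable_norm measurable_const)
    have heS0 : 0 ≤ eS := setIntegral_nonneg hSm fun y _ => by positivity
    have heST : eS ≤ eT :=
      setIntegral_mono_set hV2.integrableOn (Eventually.of_forall fun y => by positivity)
        (Eventually.of_forall fun y hy => ⟨by linarith [hy.1], by linarith [hy.2]⟩)
    have heTS : eT ≤ S L := by
      have := windowSum_ge_setIntegral hV2 hL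
      rw [hS]; exact this
    have heT0 : 0 ≤ eT := heS0.trans heST
    have hSL0 : 0 ≤ S L := heT0.trans heTS
    -- flux lemma
    have h1 := hK L hL
    -- cubic and pressure on the shell
    have hcub := shell_cubic_le hV2 hV3 hδ1 hCup hup (by linarith : R₀ ≤ L / 4)
    have hP32 : ∀ᵐ y ∂volume, ‖y‖ < 16 * L →
        P y = rieszPressure ((ball (0 : EuclideanSpace ℝ (Fin 3)) (32 * L)).indicator V) y +
          ∫ z in {z | 32 * L ≤ ‖z‖}, pressureKernel (y - z) (V z) := by
      filter_upwards [hP (32 * L) hR₁L] with y hy hy16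
      exact hy (by linarith)
    have hpre := shell_pressure_le hCS hVm hV2 hV3 hPV hδ1 hCup hup hL hR₀L hP32
    -- volume of `B̄_{8L}`
    have hvol : volume.real (closedBall (0 : EuclideanSpace ℝ (Fin 3)) (8 * L)) = (8 * L) ^ 3 * v₁ := by
      rw [Measure.addHaar_real_closedBall _ _ (by positivity), finrank_euclideanSpace_fin]
    rw [hvol] at hpre
    -- combine: `f L ≤ (K/L) (cubic + 2 pressure)`
    have hN : (∫ z, ‖V z‖ ^ 2) / (2 * Real.pi * (L / 8) ^ 3) = E₂ * (1 / (2 * Real.pi * (L / 8) ^ 3)) := by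
      rw [hE₂]; ring
    have hstep : f L ≤ K / L * (Cup * (8 * L) ^ (1 - δ) * eS +
        2 * (C_S * (Cup * (32 * L) ^ (1 - δ)) * eT +
          2 * (E₂ * (1 / (2 * Real.pi * (L / 8) ^ 3))) * Real.sqrt ((8 * L) ^ 3 * v₁) *
            Real.sqrt eS)) := by
      refine h1.trans (mul_le_mul_of_nonneg_left ?_ (by positivity))
      rw [integral_add ?_ ?_]
      · rw [integral_const_mul, ← hN]
        exact add_le_add hcub (mul_le_mul_of_nonneg_left hpre (by norm_num))
      · exact (hV3.integrableOn_isCompact (isCompact_closedBall 0 (8 * L))).mono_set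
          fun y hy => by rw [mem_closedBall, dist_zero_right]; exact hy.2
      · exact ((hPV.integrableOn_isCompact (isCompact_closedBall 0 (8 * L))).mono_set
          fun y hy => by rw [mem_closedBall, dist_zero_right]; exact hy.2).const_mul 2
    -- exponent bookkeeping
    have hA : K / L * (Cup * (8 * L) ^ (1 - δ) * eS) = K * Cup * (8 : ℝ) ^ (1 - δ) * L ^ (-δ) * eS := by
      have := mul_rpow_one_sub_div (δ := δ) (by norm_num : (0 : ℝ) < 8) hL
      calc K / L * (Cup * (8 * L) ^ (1 - δ) * eS) = K * Cup * ((8 * L) ^ (1 - δ) / L) * eS := by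
            field_simp
        _ = K * Cup * (8 : ℝ) ^ (1 - δ) * L ^ (-δ) * eS := by rw [this]; ring
    have hB : K / L * (2 * (C_S * (Cup * (32 * L) ^ (1 - δ)) * eT)) =
        2 * K * C_S * Cup * (32 : ℝ) ^ (1 - δ) * L ^ (-δ) * eT := by
      have := mul_rpow_one_sub_div (δ := δ) (by norm_num : (0 : ℝ) < 32) hL
      calc K / L * (2 * (C_S * (Cup * (32 * L) ^ (1 - δ)) * eT))
          = 2 * K * C_S * Cup * ((32 * L) ^ (1 - δ) / L) * eT := by field_simp
        _ = 2 * K * C_S * Cup * (32 : ℝ) ^ (1 - δ) * L ^ (-δ) * eT := by rw [this]; ring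
    have hC : K / L * (2 * (2 * (E₂ * (1 / (2 * Real.pi * (L / 8) ^ 3))) *
        Real.sqrt ((8 * L) ^ 3 * v₁) * Real.sqrt eS)) = C₂ * Real.sqrt eS * L ^ (-(5 / 2 : ℝ)) := by
      have := farField_scaling hL hv₁0
      calc K / L * (2 * (2 * (E₂ * (1 / (2 * Real.pi * (L / 8) ^ 3))) *
            Real.sqrt ((8 * L) ^ 3 * v₁) * Real.sqrt eS))
          = K * (4 * E₂ * (1 / (2 * Real.pi * (L / 8) ^ 3) * Real.sqrt ((8 * L) ^ 3 * v₁) / L)) *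
              Real.sqrt eS := by field_simp; ring
        _ = C₂ * Real.sqrt eS * L ^ (-(5 / 2 : ℝ)) := by rw [this, hC₂]; ring
    have hLδ : 0 < L ^ (-δ) := Real.rpow_pos_of_pos hL _
    have hL52 : 0 < L ^ (-(5 / 2 : ℝ)) := Real.rpow_pos_of_pos hL _
    calc f L ≤ K / L * (Cup * (8 * L) ^ (1 - δ) * eS) +
          K / L * (2 * (C_S * (Cup * (32 * L) ^ (1 - δ)) * eT)) +
          K / L * (2 * (2 * (E₂ * (1 / (2 * Real.pi * (L / 8) ^ 3))) *
            Real.sqrt ((8 * L) ^ 3 * v₁) * Real.sqrt eS)) := by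
          refine hstep.trans (le_of_eq ?_); ring
      _ = K * Cup * (8 : ℝ) ^ (1 - δ) * L ^ (-δ) * eS +
            2 * K * C_S * Cup * (32 : ℝ) ^ (1 - δ) * L ^ (-δ) * eT +
            C₂ * Real.sqrt eS * L ^ (-(5 / 2 : ℝ)) := by rw [hA, hB, hC]
      _ ≤ K * Cup * (8 : ℝ) ^ (1 - δ) * L ^ (-δ) * S L +
            2 * K * C_S * Cup * (32 : ℝ) ^ (1 - δ) * L ^ (-δ) * S L +
            C₂ * Real.sqrt (S L) * L ^ (-(5 / 2 : ℝ)) := by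
          gcongr
          · exact heST.trans heTS
          · exact heST.trans heTS
      _ = C₁ * L ^ (-δ) * S L + C₂ * Real.sqrt (S L) * L ^ (-(5 / 2 : ℝ)) := by
          rw [hC₁]; ring
  -- iterate
  obtain ⟨C, hC⟩ := shell_decay_of_recursion (κ := 5 / 2) (m := 5) hf0 hfB hδ hC₁0 hC₂0 hL₁0
    (fun L => rfl) hrec hε
  refine ⟨C, fun L hL => ?_⟩
  have := hC L hL
  norm_num at this ⊢
  exact this

end Decay

end Summit.NavierStokesRegularity.NavierStokesRegularity.Theorems.PowerGaugeEulerLiouville
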